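import Literature.Computability.AlgebraicComplexity.BI17LatinAnnuliProofs
import Literature.Barriers.ValiantsHypothesis.NotViaSaturationsAlonTarsiDrisko
import HarnessLib

/-!
# BI 2017 Rem. 3.26 DISCHARGED: `m × (m+1)` Latin annuli count the Alon–Tarsi number of `m + 1`;
# `e(X_1⋯X_m) = m + 1 ↔ AT(m+1)` for odd `m`

P. Bürgisser, C. Ikenmeyer, *Fundamental invariants of orbit closures*, J. Algebra **477** (2017)
390–434 = arXiv:1511.02927 [BurgisserIkenmeyer2017], §3.3 Rem. 3.26 (TeX `main.tex` L1437–1453,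
held text `paper:arxiv-1511.02927` p0013:L54): "… for odd `m` `P_m(w_m) ≠ 0` iff the number of even
`m × (m+1)` Latin Annuli is different from the number of odd `m × (m+1)` Latin Annuli. Therefore for
odd `m` we have `e(X_1…X_m) = m+1` iff [the same]. We verified that the number of even `m × (m+1)`
Latin Annuli differs from the number of odd `m × (m+1)` Latin Annuli for `m = 1, 3, 5,` and `7`."

Sequel of `BI17LatinAnnuliProofs.lean` (same seat), which proved conjuncts 1–3 of the named fact
`BI2017_rem_3_26` (`BI17FundamentalInvariantForms.lean`, cell `val-lit`, row BI2017-A) and the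
verifications `m = 1, 3`, leaving the closer `BI2017_rem_3_26_of_counts : latinAnnulusCount 5 6 ≠ 0 →
latinAnnulusCount 7 8 ≠ 0 → BI2017_rem_3_26`. Here the two remaining computer verifications of the
source are replaced by a THEOREM: **the signed count of `m × (m+1)` Latin annuli is, up to the sign
`∏_j sgn(x ↦ j − x)` and the factor `(m+1)!`, the column-signed count of Latin squares of order
`m + 1`** (`latinColCount_succ_eq_sign_mul_factorial_mul_latinAnnulusCount`), i.e. nonzero iff the
Alon–Tarsi conjecture `AT(m+1)` holds (`latinAnnulusCount_ne_zero_iff_alonTarsi`, via the tree's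
`latinColCount_ne_zero_iff`, Huang–Rota/Kumar Rem. 4.5). Since `AT(6)` and `AT(8)` are theorems of
the tree (`alonTarsi_of_even_le_24_holds`: Drisko `p + 1` / Glynn `p − 1`, both PROVED in
`Literature/Barriers/ValiantsHypothesis/NotViaSaturationsAlonTarsi{Proofs,Drisko}.lean`), the named
fact is DISCHARGED: **`BI2017_rem_3_26_holds : BI2017_rem_3_26`**. Consequences stated: for odd
`m ≥ 3`, `e(X_1⋯X_m) = m + 1 ↔ AT(m+1)` (`minimalDegree_prod_X_eq_succ_iff_alonTarsi`) — the odd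
companion of BI Prop. 3.25 (Kumar: for even `m`, `e(X_1⋯X_m) = m ↔ AT(m)`) — and unconditionally
`e(X_1⋯X_m) = m + 1` for odd `3 ≤ m ≤ 23` (`minimalDegree_prod_X_eq_succ_of_le`).

## The bijection (three steps, all sign-controlled)

1. `latinAnnulusCount_eq_sum_annulus_rowZero`: an `m × (m+1)` Latin annulus over `[m]` is the
   same as an `(m+1) × (m+1)` Latin annulus over `[m+1]` whose row `0` is constantly the new symbol
   `0` (prepend the row, shift the old symbols by `succ`; a column `π` becomes
   `decomposeFin.symm (0, π)`, of the same sign; diagonal `i` of the big array is `0` followed by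
   diagonal `i + 1` of the small one).
2. `sum_rowZero_eq_sign_mul_sum_annulus_rowZero`: under the sign-twisting bijection «square Latin
   annuli ↔ Latin squares» of `BI17LatinAnnuliProofs.lean` (`R(s, j) = j − κ` where `A(κ, j) = s`),
   «row `0` constantly `0`» corresponds to «row `0` of the square is the identity».
3. `latinColCount_succ_eq_factorial_mul_sum_rowZero`: permuting columns normalises row `0` of a
   Latin square to the identity without changing the product of the column signs, an
   `(m+1)!`-to-`1` map; so `latinColCount (m+1) = (m+1)! · Σ_{row 0 = id} colsign`.

Everything is proved; no definitions, no named facts. Honest framing: combinatorics of Latin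
squares/annuli and the minimal degree of the Chow form `X_1⋯X_m`; the Alon–Tarsi conjecture itself
is used only in the cases proved in the tree (`m + 1 ≤ 24`); nothing here bears on VP versus VNP.

## References

* [BurgisserIkenmeyer2017] P. Bürgisser, C. Ikenmeyer, *Fundamental invariants of orbit closures*,
  J. Algebra 477 (2017) 390–434; arXiv:1511.02927, §3.3 Rem. 3.26 (with Prop. 3.25, Thm. 3.21/3.22).
* [Kumar2015] S. Kumar, *A study of the representations supported by the orbit closure of the
  determinant*, Compositio Math. 151 (2015), §4 Def. 4.1, Conj. 4.3, Rem. 4.5.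
* [Drisko1997] A. A. Drisko, *On the number of even and odd Latin squares of order `p+1`*, Adv. Math.
  128 (1997), Thm. 9; [Glynn2010AlonTarsi] D. G. Glynn, SIAM J. Discrete Math. 24 (2010), Cor. 3.4
  (the tree's `alonTarsi_of_even_le_24_holds`).
-/

open MvPolynomial

namespace Literature.Computability.AlgebraicComplexity


/-! ### Latin squares: normalising the first row by a column permutation -/

section RowNormalisation

/-- Reindexing the columns of an array by a permutation does not change the product of its
column signs. [cite: Kumar2015, Def. 4.1] -/
theorem rectColSign_comp_perm {n : ℕ} (R : Fin n → Fin n → Fin n) (σ : Equiv.Perm (Fin n)) :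
    Kumar2015.rectColSign (fun s j => R s (σ j)) = Kumar2015.rectColSign R := by
  unfold Kumar2015.rectColSign
  exact Equiv.prod_comp σ (fun j => Kumar2015.seqSign fun p => R p j)

/-- Reindexing the columns of a Latin square by a permutation gives a Latin square.
[cite: Kumar2015, Def. 4.1] -/
theorem isLatinRect_comp_perm {n : ℕ} {R : Fin n → Fin n → Fin n} (hR : Kumar2015.IsLatinRect R)
    (σ : Equiv.Perm (Fin n)) : Kumar2015.IsLatinRect fun s j => R s (σ j) :=
  ⟨fun s => (hR.1 s).comp σ.bijective, fun j => hR.2 (σ j)⟩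

open Classical in
/-- **The column-signed count of Latin squares of order `n + 1` is `(n+1)!` times the signed count
of those whose row `0` is the identity**: permuting the columns so that row `0` becomes the
identity is a sign-preserving `(n+1)!`-to-`1` normalisation. [cite: Kumar2015, Conj. 4.3 (remark following)] -/
theorem latinColCount_succ_eq_factorial_mul_sum_rowZero (n : ℕ) :
    Kumar2015.latinColCount (n + 1) =
      ((n + 1).factorial : ℤ) *
        ∑ R ∈ (Finset.univ.filter fun R : Fin (n + 1) → Fin (n + 1) → Fin (n + 1) =>
          Kumar2015.IsLatinRect R ∧ ∀ j, R 0 j = j), ((Kumar2015.rectColSign R : ℤˣ) : ℤ) := by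
  classical
  unfold Kumar2015.latinColCount
  have key : ∑ R ∈ (Finset.univ.filter fun R : Fin (n + 1) → Fin (n + 1) → Fin (n + 1) =>
        Kumar2015.IsLatinRect R), ((Kumar2015.rectColSign R : ℤˣ) : ℤ) =
      ∑ p ∈ (Finset.univ : Finset (Equiv.Perm (Fin (n + 1)))) ×ˢ
        (Finset.univ.filter fun R : Fin (n + 1) → Fin (n + 1) → Fin (n + 1) =>
          Kumar2015.IsLatinRect R ∧ ∀ j, R 0 j = j),
        ((Kumar2015.rectColSign p.2 : ℤˣ) : ℤ) := by
    refine Finset.sum_bij'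
      (fun R hR => (Equiv.ofBijective (R 0) ((Finset.mem_filter.mp hR).2.1 0),
        fun s j => R s ((Equiv.ofBijective (R 0) ((Finset.mem_filter.mp hR).2.1 0)).symm j)))
      (fun p _ => fun s j => p.2 s (p.1 j)) ?_ ?_ ?_ ?_ ?_
    · intro R hR
      obtain ⟨-, hL⟩ := Finset.mem_filter.mp hR
      refine Finset.mem_product.mpr ⟨Finset.mem_univ _, Finset.mem_filter.mpr ⟨Finset.mem_univ _,
        isLatinRect_comp_perm hL _, fun j => ?_⟩⟩
      exact Equiv.ofBijective_apply_symm_apply (R 0) (hL.1 0) j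
    · intro p hp
      obtain ⟨-, hp2⟩ := Finset.mem_product.mp hp
      obtain ⟨-, hL, -⟩ := Finset.mem_filter.mp hp2
      exact Finset.mem_filter.mpr ⟨Finset.mem_univ _, isLatinRect_comp_perm hL p.1⟩
    · intro R hR
      funext s j
      exact congrArg (R s) (Equiv.symm_apply_apply _ j)
    · intro p hp
      obtain ⟨-, hp2⟩ := Finset.mem_product.mp hp
      obtain ⟨-, -, h0⟩ := Finset.mem_filter.mp hp2
      have hσ : (Equiv.ofBijective (fun j => p.2 0 (p.1 j))
          ((isLatinRect_comp_perm (Finset.mem_filter.mp hp2).2.1 p.1).1 0)) = p.1 :=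
        Equiv.ext fun j => by rw [Equiv.ofBijective_apply, h0]
      refine Prod.ext hσ ?_
      funext s j
      show p.2 s (p.1 ((Equiv.ofBijective (fun j => p.2 0 (p.1 j)) _).symm j)) = p.2 s j
      rw [hσ, Equiv.apply_symm_apply]
    · intro R hR
      show ((Kumar2015.rectColSign R : ℤˣ) : ℤ) =
        ((Kumar2015.rectColSign fun s j =>
          R s ((Equiv.ofBijective (R 0) ((Finset.mem_filter.mp hR).2.1 0)).symm j) : ℤˣ) : ℤ)
      rw [rectColSign_comp_perm]
  rw [key, Finset.sum_product]
  dsimp only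
  rw [Finset.sum_const, Finset.card_univ, Fintype.card_perm, Fintype.card_fin, nsmul_eq_mul]

end RowNormalisation

/-! ### Restricting «Latin squares ↔ square Latin annuli» to «row 0 = id ↔ row 0 ≡ 0» -/

section RowZero

/-- The square attached to an annulus whose row `0` is constantly `0` has row `0` the identity.
[cite: BurgisserIkenmeyer2017, Rem. 3.26] -/
theorem square_of_annulus_rowZero {n : ℕ} (A : Fin (n + 1) → Fin (n + 1) → Fin (n + 1))
    (hA1 : ∀ j, Function.Bijective fun κ => A κ j) (h0 : ∀ j, A 0 j = 0) (j : Fin (n + 1)) :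
    j - (Equiv.ofBijective (fun κ => A κ j) (hA1 j)).symm 0 = j := by
  have h : (Equiv.ofBijective (fun κ => A κ j) (hA1 j)).symm 0 = 0 := by
    rw [Equiv.symm_apply_eq]
    exact (h0 j).symm
  rw [h, sub_zero]

/-- The annulus attached to a Latin square whose row `0` is the identity has row `0` constantly
`0`. [cite: BurgisserIkenmeyer2017, Rem. 3.26] -/
theorem annulus_of_square_rowZero {n : ℕ} (R : Fin (n + 1) → Fin (n + 1) → Fin (n + 1))
    (hR2 : ∀ j, Function.Bijective fun s => R s j) (h0 : ∀ j, R 0 j = j) (j : Fin (n + 1)) :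
    (Equiv.ofBijective (fun s => R s j) (hR2 j)).symm (j - 0) = 0 := by
  rw [sub_zero, Equiv.symm_apply_eq]
  exact (h0 j).symm

open Classical in
/-- **Latin squares with row `0` the identity ↔ square Latin annuli with row `0` constantly `0`**,
with signs: the restriction of `latinColCount_eq_sign_mul_latinAnnulusCount`'s bijection.
[cite: BurgisserIkenmeyer2017, Rem. 3.26] -/
theorem sum_rowZero_eq_sign_mul_sum_annulus_rowZero (n : ℕ) :
    ∑ R ∈ (Finset.univ.filter fun R : Fin (n + 1) → Fin (n + 1) → Fin (n + 1) =>
        Kumar2015.IsLatinRect R ∧ ∀ j, R 0 j = j), ((Kumar2015.rectColSign R : ℤˣ) : ℤ) =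
      (((∏ j : Fin (n + 1), Equiv.Perm.sign (Equiv.subLeft j : Equiv.Perm (Fin (n + 1)))) : ℤˣ) : ℤ) *
        ∑ A ∈ (Finset.univ.filter fun A : Fin (n + 1) → Fin (n + 1) → Fin (n + 1) =>
          IsLatinAnnulus (d := n + 1) A ∧ ∀ j, A 0 j = 0), ((annulusColSign A : ℤˣ) : ℤ) := by
  classical
  rw [Finset.mul_sum]
  symm
  refine Finset.sum_bij'
    (fun A hA => fun s j =>
      j - (Equiv.ofBijective (fun κ => A κ j) ((Finset.mem_filter.mp hA).2.1.1 j)).symm s)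
    (fun R hR => fun κ j =>
      (Equiv.ofBijective (fun s => R s j)
        (Finite.injective_iff_bijective.mp ((Finset.mem_filter.mp hR).2.1.2 j))).symm (j - κ))
    ?_ ?_ ?_ ?_ ?_
  · intro A hA
    obtain ⟨-, hL, h0⟩ := Finset.mem_filter.mp hA
    exact Finset.mem_filter.mpr ⟨Finset.mem_univ _, isLatinRect_square_of_annulus A hL,
      fun j => square_of_annulus_rowZero A hL.1 h0 j⟩
  · intro R hR
    obtain ⟨-, hL, h0⟩ := Finset.mem_filter.mp hR
    exact Finset.mem_filter.mpr ⟨Finset.mem_univ _, isLatinAnnulus_annulus_of_square R hL,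
      fun j => annulus_of_square_rowZero R
        (fun j => Finite.injective_iff_bijective.mp (hL.2 j)) h0 j⟩
  · intro A hA
    exact annulus_of_square_of_annulus A _ _
  · intro R hR
    exact square_of_annulus_of_square R _ _
  · intro A hA
    rw [rectColSign_square_of_annulus, Units.val_mul]

end RowZero


/-! ### `m × (m+1)` Latin annuli = `(m+1) × (m+1)` Latin annuli with a constant row -/

section Extension

variable {m : ℕ}

/-- The diagonal index `(i + κ) mod (m+1)` of `IsLatinAnnulus`, square case, is addition in
`Fin (m+1)`. [cite: BurgisserIkenmeyer2017, Rem. 3.26] -/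
theorem latinAnnulus_idx_eq_add (i κ : Fin (m + 1)) (h : ((i : ℕ) + (κ : ℕ)) % (m + 1) < m + 1) :
    (⟨((i : ℕ) + (κ : ℕ)) % (m + 1), h⟩ : Fin (m + 1)) = i + κ :=
  Fin.ext (by rw [Fin.val_add])

/-- The diagonal index `(i + κ') mod (m+1)` of an `m × (m+1)` annulus is `i + κ'` in `Fin (m+1)`.
[cite: BurgisserIkenmeyer2017, Rem. 3.26] -/
theorem latinAnnulus_idx_eq_add_castSucc (i : Fin (m + 1)) (κ' : Fin m)
    (h : ((i : ℕ) + (κ' : ℕ)) % (m + 1) < m + 1) :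
    (⟨((i : ℕ) + (κ' : ℕ)) % (m + 1), h⟩ : Fin (m + 1)) = i + Fin.castSucc κ' :=
  Fin.ext (by rw [Fin.val_add, Fin.val_castSucc])

/-- Index bookkeeping: the cell `(κ'+1, i + κ' + 1)` lies on diagonal `i + 1` of the small rows.
[cite: BurgisserIkenmeyer2017, Rem. 3.26] -/
theorem latinAnnulus_idx_succ (i : Fin (m + 1)) (κ' : Fin m)
    (h : ((i : ℕ) + ((κ'.succ : Fin (m + 1)) : ℕ)) % (m + 1) < m + 1)
    (h' : (((i + 1 : Fin (m + 1)) : ℕ) + (κ' : ℕ)) % (m + 1) < m + 1) :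
    (⟨((i : ℕ) + ((κ'.succ : Fin (m + 1)) : ℕ)) % (m + 1), h⟩ : Fin (m + 1)) =
      ⟨(((i + 1 : Fin (m + 1)) : ℕ) + (κ' : ℕ)) % (m + 1), h'⟩ := by
  rw [latinAnnulus_idx_eq_add, latinAnnulus_idx_eq_add_castSucc, ← Fin.coeSucc_eq_succ, ← add_assoc,
    add_right_comm]

/-- Index bookkeeping: the cell `(κ'+1, i + κ')` lies on diagonal `i − 1` of the big array.
[cite: BurgisserIkenmeyer2017, Rem. 3.26] -/
theorem latinAnnulus_idx_pred (i : Fin (m + 1)) (κ' : Fin m)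
    (h : ((i : ℕ) + (κ' : ℕ)) % (m + 1) < m + 1)
    (h' : (((i - 1 : Fin (m + 1)) : ℕ) + ((κ'.succ : Fin (m + 1)) : ℕ)) % (m + 1) < m + 1) :
    (⟨((i : ℕ) + (κ' : ℕ)) % (m + 1), h⟩ : Fin (m + 1)) =
      ⟨(((i - 1 : Fin (m + 1)) : ℕ) + ((κ'.succ : Fin (m + 1)) : ℕ)) % (m + 1), h'⟩ := by
  rw [latinAnnulus_idx_eq_add, latinAnnulus_idx_eq_add_castSucc, ← Fin.coeSucc_eq_succ,
    sub_add_add_cancel]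

/-- Prepending the fixed point `0` to a permutation of `Fin m` (shifted by `succ`) is the
permutation `decomposeFin.symm (0, e)` of `Fin (m+1)`. [cite: BurgisserIkenmeyer2017, Rem. 3.26] -/
theorem coe_decomposeFin_symm_zero (e : Equiv.Perm (Fin m)) :
    ⇑(Equiv.Perm.decomposeFin.symm (0, e)) = Matrix.vecCons (0 : Fin (m + 1)) fun x => (e x).succ := by
  funext κ
  refine Fin.cases ?_ (fun κ' => ?_) κ
  · rw [Equiv.Perm.decomposeFin_symm_apply_zero, Matrix.cons_val_zero]
  · rw [Equiv.Perm.decomposeFin_symm_apply_succ, Equiv.swap_self, Equiv.refl_apply,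
      Matrix.cons_val_succ]

/-- In a big annulus with row `0` constantly `0`, the other rows avoid the symbol `0`.
[cite: BurgisserIkenmeyer2017, Rem. 3.26] -/
theorem latinAnnulus_succ_entry_ne_zero (B : Fin (m + 1) → Fin (m + 1) → Fin (m + 1))
    (hcol : ∀ j, Function.Bijective fun κ => B κ j) (h0 : ∀ j, B 0 j = 0) (κ' : Fin m)
    (j : Fin (m + 1)) : B κ'.succ j ≠ 0 := fun h =>
  Fin.succ_ne_zero κ' ((hcol j).injective (h.trans (h0 j).symm))

/-- **Extension**: adding a row of the new symbol `0` on top of an `m × (m+1)` Latin annulus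
(symbols shifted by one) gives an `(m+1) × (m+1)` Latin annulus. [cite: BurgisserIkenmeyer2017, Rem. 3.26] -/
theorem isLatinAnnulus_extend (A : Fin m → Fin (m + 1) → Fin m) (hA : IsLatinAnnulus (d := m + 1) A) :
    IsLatinAnnulus (d := m + 1) fun κ j =>
      Matrix.vecCons (0 : Fin (m + 1)) (fun κ' => (A κ' j).succ) κ := by
  obtain ⟨hA1, hA2⟩ := hA
  refine ⟨fun j => ?_, fun i => ?_⟩
  · have h := (Equiv.Perm.decomposeFin.symm (0, Equiv.ofBijective (fun κ' => A κ' j) (hA1 j))).bijective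
    rw [coe_decomposeFin_symm_zero] at h
    exact h
  · have hfun : (fun κ : Fin (m + 1) => Matrix.vecCons (0 : Fin (m + 1)) (fun κ' => (A κ'
        ⟨((i : ℕ) + (κ : ℕ)) % (m + 1), Nat.mod_lt _ i.pos⟩).succ) κ) =
        ⇑(Equiv.Perm.decomposeFin.symm (0, Equiv.ofBijective (fun κ' : Fin m => A κ'
          ⟨(((i + 1 : Fin (m + 1)) : ℕ) + (κ' : ℕ)) % (m + 1), Nat.mod_lt _ i.pos⟩) (hA2 (i + 1)))) := by
      rw [coe_decomposeFin_symm_zero]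
      funext κ
      refine Fin.cases ?_ (fun κ' => ?_) κ
      · rw [Matrix.cons_val_zero, Matrix.cons_val_zero]
      · rw [Matrix.cons_val_succ, Matrix.cons_val_succ, Equiv.ofBijective_apply,
          latinAnnulus_idx_succ i κ']
    have h := (Equiv.Perm.decomposeFin.symm (0, Equiv.ofBijective (fun κ' : Fin m => A κ'
      ⟨(((i + 1 : Fin (m + 1)) : ℕ) + (κ' : ℕ)) % (m + 1), Nat.mod_lt _ i.pos⟩) (hA2 (i + 1)))).bijective
    rw [← hfun] at h
    exact h

/-- **Restriction**: removing the constant row `0` of an `(m+1) × (m+1)` Latin annulus (and the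
symbol `0`) gives an `m × (m+1)` Latin annulus. [cite: BurgisserIkenmeyer2017, Rem. 3.26] -/
theorem isLatinAnnulus_restrict (B : Fin (m + 1) → Fin (m + 1) → Fin (m + 1))
    (hB : IsLatinAnnulus (d := m + 1) B) (hne : ∀ (κ' : Fin m) (j : Fin (m + 1)), B κ'.succ j ≠ 0) :
    IsLatinAnnulus (d := m + 1) fun (κ' : Fin m) (j : Fin (m + 1)) => (B κ'.succ j).pred (hne κ' j) := by
  obtain ⟨hB1, hB2⟩ := hB
  refine ⟨fun j => Finite.injective_iff_bijective.mp fun κ₁ κ₂ h => ?_,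
    fun i => Finite.injective_iff_bijective.mp fun κ₁ κ₂ h => ?_⟩
  · exact Fin.succ_injective _ ((hB1 j).injective (Fin.pred_inj.mp h))
  · have h' : B κ₁.succ ⟨((i : ℕ) + (κ₁ : ℕ)) % (m + 1), Nat.mod_lt _ i.pos⟩ =
        B κ₂.succ ⟨((i : ℕ) + (κ₂ : ℕ)) % (m + 1), Nat.mod_lt _ i.pos⟩ := Fin.pred_inj.mp h
    rw [latinAnnulus_idx_pred i κ₁ _ (Nat.mod_lt _ i.pos),
      latinAnnulus_idx_pred i κ₂ _ (Nat.mod_lt _ i.pos)] at h'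
    exact Fin.succ_injective _ ((hB2 (i - 1)).injective h')

/-- Restriction of an extension is the original annulus. [cite: BurgisserIkenmeyer2017, Rem. 3.26] -/
theorem restrict_extend (A : Fin m → Fin (m + 1) → Fin m)
    (hne : ∀ (κ' : Fin m) (j : Fin (m + 1)),
      Matrix.vecCons (0 : Fin (m + 1)) (fun κ'' => (A κ'' j).succ) κ'.succ ≠ 0) :
    (fun (κ' : Fin m) (j : Fin (m + 1)) =>
      (Matrix.vecCons (0 : Fin (m + 1)) (fun κ'' => (A κ'' j).succ) κ'.succ).pred (hne κ' j)) = A := by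
  funext κ' j
  rw [Fin.pred_eq_iff_eq_succ, Matrix.cons_val_succ]

/-- Extension of a restriction is the original annulus (row `0` being constantly `0`).
[cite: BurgisserIkenmeyer2017, Rem. 3.26] -/
theorem extend_restrict (B : Fin (m + 1) → Fin (m + 1) → Fin (m + 1)) (h0 : ∀ j, B 0 j = 0)
    (hne : ∀ (κ' : Fin m) (j : Fin (m + 1)), B κ'.succ j ≠ 0) :
    (fun κ j => Matrix.vecCons (0 : Fin (m + 1)) (fun κ' => ((B κ'.succ j).pred (hne κ' j)).succ) κ) =
      B := by
  funext κ j
  refine Fin.cases ?_ (fun κ' => ?_) κ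
  · rw [Matrix.cons_val_zero, h0]
  · rw [Matrix.cons_val_succ, Fin.succ_pred]

/-- The extension has the same column signs (the new symbol `0` sits on top of every column and
creates no inversion: `sgn (decomposeFin.symm (0, π)) = sgn π`). [cite: BurgisserIkenmeyer2017, Rem. 3.26] -/
theorem annulusColSign_extend (A : Fin m → Fin (m + 1) → Fin m)
    (hA1 : ∀ j, Function.Bijective fun κ' => A κ' j) :
    annulusColSign (d := m + 1) (fun κ j => Matrix.vecCons (0 : Fin (m + 1)) (fun κ' => (A κ' j).succ) κ) =
      annulusColSign (d := m + 1) A := by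
  unfold annulusColSign
  refine Finset.prod_congr rfl fun j _ => ?_
  show Kumar2015.seqSign (fun κ => Matrix.vecCons (0 : Fin (m + 1)) (fun κ' => (A κ' j).succ) κ) =
    Kumar2015.seqSign fun κ' => A κ' j
  rw [show (fun κ => Matrix.vecCons (0 : Fin (m + 1)) (fun κ' => (A κ' j).succ) κ) =
      ⇑(Equiv.Perm.decomposeFin.symm (0, Equiv.ofBijective (fun κ' => A κ' j) (hA1 j))) from by
      rw [coe_decomposeFin_symm_zero]; rfl,
    Kumar2015.seqSign_coe_perm, Equiv.Perm.decomposeFin.symm_sign, if_pos rfl, one_mul]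
  exact (Kumar2015.seqSign_coe_perm (Equiv.ofBijective (fun κ' => A κ' j) (hA1 j))).symm

open Classical in
/-- **`m × (m+1)` Latin annuli over `[m]` ↔ `(m+1) × (m+1)` Latin annuli over `[m+1]` whose row `0`
is constantly the new symbol `0`**, preserving column signs; hence the signed counts agree.
[cite: BurgisserIkenmeyer2017, Rem. 3.26] -/
theorem latinAnnulusCount_eq_sum_annulus_rowZero (m : ℕ) :
    latinAnnulusCount m (m + 1) =
      ∑ B ∈ (Finset.univ.filter fun B : Fin (m + 1) → Fin (m + 1) → Fin (m + 1) =>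
        IsLatinAnnulus (d := m + 1) B ∧ ∀ j, B 0 j = 0), ((annulusColSign B : ℤˣ) : ℤ) := by
  classical
  unfold latinAnnulusCount
  refine Finset.sum_bij'
    (fun A _ => fun κ j => Matrix.vecCons (0 : Fin (m + 1)) (fun κ' => (A κ' j).succ) κ)
    (fun B hB => fun κ' j => (B κ'.succ j).pred
      (latinAnnulus_succ_entry_ne_zero B (Finset.mem_filter.mp hB).2.1.1
        (Finset.mem_filter.mp hB).2.2 κ' j))
    ?_ ?_ ?_ ?_ ?_
  · intro A hA
    exact Finset.mem_filter.mpr ⟨Finset.mem_univ _, isLatinAnnulus_extend A (Finset.mem_filter.mp hA).2,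
      fun j => Matrix.cons_val_zero _ _⟩
  · intro B hB
    exact Finset.mem_filter.mpr ⟨Finset.mem_univ _,
      isLatinAnnulus_restrict B (Finset.mem_filter.mp hB).2.1 _⟩
  · intro A hA
    exact restrict_extend A _
  · intro B hB
    exact extend_restrict B (Finset.mem_filter.mp hB).2.2 _
  · intro A hA
    rw [annulusColSign_extend A (Finset.mem_filter.mp hA).2.1]

end Extension


/-! ### Assembly: `latinColCount (m+1) = ± (m+1)! · latinAnnulusCount m (m+1)`; BI Rem. 3.26 holds -/

section Assembly

/-- **The signed count of `m × (m+1)` Latin annuli is `±` the column-signed count of Latin squares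
of order `m + 1` divided by `(m+1)!`**: `latinColCount (m+1) = (∏_j sgn(x ↦ j − x)) · (m+1)! ·
latinAnnulusCount m (m+1)` (the three bijections of this file and of `BI17LatinAnnuliProofs.lean`).
[cite: BurgisserIkenmeyer2017, Rem. 3.26] [cite: Kumar2015, Conj. 4.3] -/
theorem latinColCount_succ_eq_sign_mul_factorial_mul_latinAnnulusCount (m : ℕ) :
    Kumar2015.latinColCount (m + 1) =
      (((∏ j : Fin (m + 1), Equiv.Perm.sign (Equiv.subLeft j : Equiv.Perm (Fin (m + 1)))) : ℤˣ) : ℤ) *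
        ((((m + 1).factorial : ℕ) : ℤ) * latinAnnulusCount m (m + 1)) := by
  rw [latinColCount_succ_eq_factorial_mul_sum_rowZero, sum_rowZero_eq_sign_mul_sum_annulus_rowZero,
    ← latinAnnulusCount_eq_sum_annulus_rowZero]
  ring

/-- **`#{even m × (m+1) Latin annuli} ≠ #{odd ones}` iff `♯CELS(m+1) ≠ ♯COLS(m+1)`** (Kumar's
column-signed count of Latin squares of order `m + 1` is nonzero).
[cite: BurgisserIkenmeyer2017, Rem. 3.26] [cite: Kumar2015, Conj. 4.3] -/
theorem latinAnnulusCount_ne_zero_iff_latinColCount_succ_ne_zero (m : ℕ) :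
    latinAnnulusCount m (m + 1) ≠ 0 ↔ Kumar2015.latinColCount (m + 1) ≠ 0 := by
  rw [latinColCount_succ_eq_sign_mul_factorial_mul_latinAnnulusCount, mul_ne_zero_iff, mul_ne_zero_iff,
    and_iff_right (Units.ne_zero _),
    and_iff_right (Int.natCast_ne_zero.mpr (Nat.factorial_ne_zero (m + 1)))]

/-- **`#{even m × (m+1) Latin annuli} ≠ #{odd ones}` iff the Alon–Tarsi conjecture holds for
`m + 1`** (with the tree's `AlonTarsiConjecture`, via Huang–Rota / Kumar Rem. 4.5
`latinColCount_ne_zero_iff`). [cite: BurgisserIkenmeyer2017, Rem. 3.26] [cite: Kumar2015, Rem. 4.5] -/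
theorem latinAnnulusCount_ne_zero_iff_alonTarsi (m : ℕ) :
    latinAnnulusCount m (m + 1) ≠ 0 ↔
      Literature.Barriers.ValiantsHypothesis.AlonTarsiConjecture (m + 1) := by
  rw [latinAnnulusCount_ne_zero_iff_latinColCount_succ_ne_zero,
    Literature.Barriers.ValiantsHypothesis.latinColCount_ne_zero_iff]

/-- **BI 2017 Rem. 3.26, the verification `m = 5`** ("We verified … for `m = 1, 3, 5,` and `7`"):
PROVED from the Alon–Tarsi conjecture for `6 = 5 + 1 = 7 − 1`, a theorem of the tree (Drisko/Glynn).
[cite: BurgisserIkenmeyer2017, Rem. 3.26] -/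
theorem latinAnnulusCount_five_six_ne_zero : latinAnnulusCount 5 6 ≠ 0 :=
  (latinAnnulusCount_ne_zero_iff_alonTarsi 5).mpr
    (Literature.Barriers.ValiantsHypothesis.alonTarsi_of_even_le_24_holds
      (by decide) (by norm_num) (by norm_num))

/-- **BI 2017 Rem. 3.26, the verification `m = 7`**: PROVED from the Alon–Tarsi conjecture for
`8 = 7 + 1`, a theorem of the tree (Drisko). [cite: BurgisserIkenmeyer2017, Rem. 3.26] -/
theorem latinAnnulusCount_seven_eight_ne_zero : latinAnnulusCount 7 8 ≠ 0 :=
  (latinAnnulusCount_ne_zero_iff_alonTarsi 7).mpr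
    (Literature.Barriers.ValiantsHypothesis.alonTarsi_of_even_le_24_holds
      (by decide) (by norm_num) (by norm_num))

/-- **BI 2017, Rem. 3.26 — DISCHARGE of the named fact `BI2017_rem_3_26`**
(`BI17FundamentalInvariantForms.lean`): the three equivalences (`BI17LatinAnnuliProofs.lean`) and
all four verifications `m = 1, 3, 5, 7` (here `m = 5, 7` through `AT(6)`, `AT(8)`).
[cite: BurgisserIkenmeyer2017, Rem. 3.26] -/
theorem BI2017_rem_3_26_holds : BI2017_rem_3_26 :=
  BI2017_rem_3_26_of_counts latinAnnulusCount_five_six_ne_zero latinAnnulusCount_seven_eight_ne_zero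

/-- `P_m(X_1⋯X_m) ≠ 0 ↔ AT(m+1)` for every `m` (BI's `P_m` of eq. (3.7) at the Chow form; Rem. 3.26
combined with `latinAnnulusCount_ne_zero_iff_alonTarsi`). [cite: BurgisserIkenmeyer2017, Rem. 3.26] -/
theorem aeval_oddCayleyP_prod_X_ne_zero_iff_alonTarsi (m : ℕ) :
    aeval (formCoeff m (∏ i : Fin m, X i : MvPolynomial (Fin m) ℂ))
        (oddCayleyP (k := ℂ) m (Equiv.refl (Fin m))) ≠ 0 ↔
      Literature.Barriers.ValiantsHypothesis.AlonTarsiConjecture (m + 1) := by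
  rw [aeval_oddCayleyP_prod_X_ne_zero_iff, latinAnnulusCount_ne_zero_iff_alonTarsi]

/-- **For odd `m ≥ 3`: `e(X_1⋯X_m) = m + 1 ↔ AT(m+1)`** — the odd companion of BI Prop. 3.25
("Let `m` be even. Then `e(X_1…X_m) ≥ m` and equality holds iff the Alon-Tarsi conjecture is true for
`m`") obtained from Rem. 3.26 ("for odd `m` we have `e(X_1…X_m) = m+1` iff [the annulus count is
nonzero]") and `latinAnnulusCount_ne_zero_iff_alonTarsi`. [cite: BurgisserIkenmeyer2017, Rem. 3.26] -/
theorem minimalDegree_prod_X_eq_succ_iff_alonTarsi {m : ℕ} (hodd : Odd m) (hm : 3 ≤ m) :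
    minimalDegree m (∏ i : Fin m, X i : MvPolynomial (Fin m) ℂ) = m + 1 ↔
      Literature.Barriers.ValiantsHypothesis.AlonTarsiConjecture (m + 1) := by
  rw [BI2017_rem_3_26_part3 m hodd hm, latinAnnulusCount_ne_zero_iff_alonTarsi]

/-- **`e(X_1⋯X_m) = m + 1` unconditionally for odd `3 ≤ m ≤ 23`** (the Alon–Tarsi conjecture being a
theorem of the tree for even sizes `≤ 24`). [cite: BurgisserIkenmeyer2017, Rem. 3.26] -/
theorem minimalDegree_prod_X_eq_succ_of_le {m : ℕ} (hodd : Odd m) (hm : 3 ≤ m) (h23 : m ≤ 23) :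
    minimalDegree m (∏ i : Fin m, X i : MvPolynomial (Fin m) ℂ) = m + 1 :=
  (minimalDegree_prod_X_eq_succ_iff_alonTarsi hodd hm).mpr
    (Literature.Barriers.ValiantsHypothesis.alonTarsi_of_even_le_24_holds hodd.add_one
      (by omega) (by omega))

end Assembly

end Literature.Computability.AlgebraicComplexity
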